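import Mathlib
import Summits.Ventures.PercRepro2.CoinKSureAD
import Summits.Ventures.PercRepro2.CoinChainMixLsm
import Summits.Ventures.PercRepro2.CoinChainWorld1

/-!
# The (★) identity of the PURE chain, and the chain under SAME-SIGN world shifts
(blind cell PercRepro2, night-2 g18; proofs/NIGHT2-DARC.md §58)

The PURE chain is the chained OR-vertex `a' → a` of §56 with NO direct entry of `a` (`ent = ∅`):
`a'` entered from `ent' ⊆ U` (sure coins), `a` entered from `a'` alone by the chain coin of
probability `ρ`.  Its κ-integrated laws on the core levels are mixtures of THREE laws — the
world-0 law `L₀ = ν·c` (chain coin closed: `a` never entered), the world-1 `R`-law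
`L₁ = ν·chainMix ∅ ent' 1 c d` and the world-1 gate `G₁ = ν·chainMix ∅ ent' 1 c d'`:
`R_ρ = (1−ρ)·L₀ + ρ·L₁`, `G'_ρ = (1−ρ)·L₀ + ρ·G₁` (`chainMix_affine`).

**The (★) identity** (`chain_star_identity`, a ring identity in the twelve moments): with
`Λ₀, Λ₁` the masses of `L₀, L₁`, `M` the mass of `G₁`, `Λ_ρ = (1−ρ)Λ₀ + ρΛ₁`,
`D₀ = Λ₀Λ₁₂⁰ − Λ₁⁰Λ₂⁰` the cleared FKG covariance of `L₀`, `T₀₁ = T(L₀, G₁)`, `T₁₁ = T(L₁, G₁)`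
the cleared functionals of the world-1 gate centred at the world-0 resp. world-1 `R`-means, and
`Δ = (Λ₁Λ₁⁰ − Λ₀Λ₁¹)(Λ₁Λ₂⁰ − Λ₀Λ₂¹) = Λ₀²Λ₁²·(p₀ − p₁)(q₀ − q₁)` the product of the shifts of
the two marker means from world 0 to world 1:

  `Λ₀Λ₁·T(R_ρ, G'_ρ) = (1−ρ)Λ₁Λ_ρ²·D₀ + ρ(1−ρ)Λ₁Λ_ρ·T₀₁ + ρ²Λ₀Λ_ρ·T₁₁ + ρ²(1−ρ)(Λ₁ − M)·Δ`.

`D₀ ≥ 0` is FKG (`ad_pointwise`), `T₀₁ ≥ 0` and `T₁₁ ≥ 0` are the coin-open theorem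
`chain_world1_nonneg` at `ρ = 0` and `ρ = 1`, and `Λ₁ − M ≥ 0` is the world-1 pivotal mass.
Hence **`pureChain_functional_nonneg_of_sameSign`**: the pure chain functional is `≥ 0` whenever
the chain coin shifts the two marker means in the SAME direction (`Δ ≥ 0`); and the identity
locates the whole remaining difficulty of the general chain in the single term
`ρ²(1−ρ)Λ₀Λ₁·|β|·δ` with `δ < 0` (NIGHT2-DARC.md §58: the abstract pure chain (APC) is
census-true there, 0 / 18,470, and every hypothesis of (APC) is load-bearing).
-/

namespace Summit.Ventures.PercRepro2.Coin

section StarIdentity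

variable {R : Type*} [CommRing R]

/-- **The (★) identity.**  `a0 a1 a2 a12` are the mass, the two marker moments and the joint
moment of the world-0 law, `b0 b1 b2` the mass and marker moments of the world-1 `R`-law,
`g0 g1 g2 g12` those of the world-1 gate; the left side is `Λ₀Λ₁` times the cleared functional
of the mixtures `(1−ρ)·L₀ + ρ·L₁` (`R`-law) and `(1−ρ)·L₀ + ρ·G₁` (gate). -/
theorem chain_star_identity (a0 a1 a2 a12 b0 b1 b2 g0 g1 g2 g12 ρ : R) :
    a0 * b0 *
      (((1 - ρ) * a0 + ρ * b0) ^ 2 * ((1 - ρ) * a12 + ρ * g12)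
        - ((1 - ρ) * a0 + ρ * b0) * ((1 - ρ) * a1 + ρ * b1) * ((1 - ρ) * a2 + ρ * g2)
        - ((1 - ρ) * a0 + ρ * b0) * ((1 - ρ) * a2 + ρ * b2) * ((1 - ρ) * a1 + ρ * g1)
        + ((1 - ρ) * a1 + ρ * b1) * ((1 - ρ) * a2 + ρ * b2) * ((1 - ρ) * a0 + ρ * g0)) =
      (1 - ρ) * b0 * ((1 - ρ) * a0 + ρ * b0) ^ 2 * (a0 * a12 - a1 * a2)
        + ρ * (1 - ρ) * b0 * ((1 - ρ) * a0 + ρ * b0) *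
            (a0 ^ 2 * g12 - a0 * a1 * g2 - a0 * a2 * g1 + a1 * a2 * g0)
        + ρ ^ 2 * a0 * ((1 - ρ) * a0 + ρ * b0) *
            (b0 ^ 2 * g12 - b0 * b1 * g2 - b0 * b2 * g1 + b1 * b2 * g0)
        + ρ ^ 2 * (1 - ρ) * (b0 - g0) * ((b0 * a1 - a0 * b1) * (b0 * a2 - a0 * b2)) := by
  ring

end StarIdentity

section StarNonneg

variable {R : Type*} [Field R] [LinearOrder R] [IsStrictOrderedRing R]

/-- **The cleared mixture functional is nonnegative** when the four terms of (★) are: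
`D₀ ≥ 0` (FKG of the world-0 law), `T₀₁, T₁₁ ≥ 0` (the world-1 gate centred at either world's
`R`-means), `g0 ≤ b0` (the gate is dominated by the world-1 `R`-law) and `Δ ≥ 0` (the two marker
means shift the same way from world 0 to world 1). -/
theorem chain_star_nonneg (a0 a1 a2 a12 b0 b1 b2 g0 g1 g2 g12 ρ : R)
    (hρ0 : 0 ≤ ρ) (hρ1 : ρ ≤ 1) (ha0 : 0 ≤ a0) (hb0 : 0 ≤ b0) (hbg : g0 ≤ b0)
    (hD : 0 ≤ a0 * a12 - a1 * a2)
    (hT01 : 0 ≤ a0 ^ 2 * g12 - a0 * a1 * g2 - a0 * a2 * g1 + a1 * a2 * g0)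
    (hT11 : 0 ≤ b0 ^ 2 * g12 - b0 * b1 * g2 - b0 * b2 * g1 + b1 * b2 * g0)
    (hΔ : 0 ≤ (b0 * a1 - a0 * b1) * (b0 * a2 - a0 * b2)) :
    0 ≤ a0 * b0 *
      (((1 - ρ) * a0 + ρ * b0) ^ 2 * ((1 - ρ) * a12 + ρ * g12)
        - ((1 - ρ) * a0 + ρ * b0) * ((1 - ρ) * a1 + ρ * b1) * ((1 - ρ) * a2 + ρ * g2)
        - ((1 - ρ) * a0 + ρ * b0) * ((1 - ρ) * a2 + ρ * b2) * ((1 - ρ) * a1 + ρ * g1)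
        + ((1 - ρ) * a1 + ρ * b1) * ((1 - ρ) * a2 + ρ * b2) * ((1 - ρ) * a0 + ρ * g0)) := by
  rw [chain_star_identity]
  have h1ρ : 0 ≤ 1 - ρ := by linarith
  have hr : 0 ≤ (1 - ρ) * a0 + ρ * b0 := add_nonneg (mul_nonneg h1ρ ha0) (mul_nonneg hρ0 hb0)
  have hbg' : 0 ≤ b0 - g0 := by linarith
  have t1 : 0 ≤ (1 - ρ) * b0 * ((1 - ρ) * a0 + ρ * b0) ^ 2 * (a0 * a12 - a1 * a2) :=
    mul_nonneg (mul_nonneg (mul_nonneg h1ρ hb0) (pow_nonneg hr 2)) hD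
  have t2 : 0 ≤ ρ * (1 - ρ) * b0 * ((1 - ρ) * a0 + ρ * b0) *
      (a0 ^ 2 * g12 - a0 * a1 * g2 - a0 * a2 * g1 + a1 * a2 * g0) :=
    mul_nonneg (mul_nonneg (mul_nonneg (mul_nonneg hρ0 h1ρ) hb0) hr) hT01
  have t3 : 0 ≤ ρ ^ 2 * a0 * ((1 - ρ) * a0 + ρ * b0) *
      (b0 ^ 2 * g12 - b0 * b1 * g2 - b0 * b2 * g1 + b1 * b2 * g0) :=
    mul_nonneg (mul_nonneg (mul_nonneg (pow_nonneg hρ0 2) ha0) hr) hT11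
  have t4 : 0 ≤ ρ ^ 2 * (1 - ρ) * (b0 - g0) * ((b0 * a1 - a0 * b1) * (b0 * a2 - a0 * b2)) :=
    mul_nonneg (mul_nonneg (mul_nonneg (pow_nonneg hρ0 2) h1ρ) hbg') hΔ
  linarith

/-- The same with the masses positive: the functional itself is nonnegative. -/
theorem chain_star_nonneg' (a0 a1 a2 a12 b0 b1 b2 g0 g1 g2 g12 ρ : R)
    (hρ0 : 0 ≤ ρ) (hρ1 : ρ ≤ 1) (ha0 : 0 < a0) (hb0 : 0 < b0) (hbg : g0 ≤ b0)
    (hD : 0 ≤ a0 * a12 - a1 * a2)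
    (hT01 : 0 ≤ a0 ^ 2 * g12 - a0 * a1 * g2 - a0 * a2 * g1 + a1 * a2 * g0)
    (hT11 : 0 ≤ b0 ^ 2 * g12 - b0 * b1 * g2 - b0 * b2 * g1 + b1 * b2 * g0)
    (hΔ : 0 ≤ (b0 * a1 - a0 * b1) * (b0 * a2 - a0 * b2)) :
    0 ≤ ((1 - ρ) * a0 + ρ * b0) ^ 2 * ((1 - ρ) * a12 + ρ * g12)
        - ((1 - ρ) * a0 + ρ * b0) * ((1 - ρ) * a1 + ρ * b1) * ((1 - ρ) * a2 + ρ * g2)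
        - ((1 - ρ) * a0 + ρ * b0) * ((1 - ρ) * a2 + ρ * b2) * ((1 - ρ) * a1 + ρ * g1)
        + ((1 - ρ) * a1 + ρ * b1) * ((1 - ρ) * a2 + ρ * b2) * ((1 - ρ) * a0 + ρ * g0) := by
  have h := chain_star_nonneg a0 a1 a2 a12 b0 b1 b2 g0 g1 g2 g12 ρ hρ0 hρ1 ha0.le hb0.le hbg hD
    hT01 hT11 hΔ
  exact (mul_nonneg_iff_of_pos_left (mul_pos ha0 hb0)).mp h

end StarNonneg

section PureChain

variable {V : Type*} [DecidableEq V] {R : Type*} [Field R] [LinearOrder R] [IsStrictOrderedRing R]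

omit [LinearOrder R] [IsStrictOrderedRing R] in
/-- The κ-integrated value is AFFINE in the chain coin: `chainMix ρ = (1−ρ)·chainMix 0 + ρ·chainMix 1`
(for every entry structure). -/
lemma chainMix_affine (ent ent' : Finset V) (ρ : R) (c d : Finset V → R) (W : Finset V) :
    chainMix ent ent' ρ c d W =
      (1 - ρ) * chainMix ent ent' 0 c d W + ρ * chainMix ent ent' 1 c d W := by
  unfold chainMix chainTheta
  split_ifs <;> ring

omit [LinearOrder R] [IsStrictOrderedRing R] in
/-- With no direct entry (`ent = ∅`) the coin-closed value is the closure value `c`. -/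
lemma chainMix_zero_empty (ent' : Finset V) (c d : Finset V → R) (W : Finset V) :
    chainMix ∅ ent' 0 c d W = c W := by
  unfold chainMix chainTheta
  simp

/-- The world-1 gate is dominated by the world-1 `R`-law when `d' ≤ d`. -/
lemma chainMix_one_mono (ent ent' : Finset V) {c d d' : Finset V → R} (hd'd : ∀ W, d' W ≤ d W)
    (W : Finset V) : chainMix ent ent' 1 c d' W ≤ chainMix ent ent' 1 c d W := by
  unfold chainMix
  have h1 := chainTheta_nonneg ent ent' (ρ := (1 : R)) zero_le_one W
  have := hd'd W
  nlinarith

/-- **THEOREM (the PURE chain under same-sign world shifts).**  For the κ-integrated pair of the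
pure chain (`ent = ∅`): `R_ρ = ν · chainMix ∅ ent' ρ c d`, `G'_ρ = ν · chainMix ∅ ent' ρ c d'`,
with the hypotheses of `chain_world1_nonneg`, `d' ≤ d`, positive masses of the world-0 and
world-1 `R`-laws, and the SAME-SIGN hypothesis `hsign` (the product of the two cleared shifts
`Λ₁Λ₁⁰ − Λ₀Λ₁¹` and `Λ₁Λ₂⁰ − Λ₀Λ₂¹` of the marker means from world 0 to world 1 is `≥ 0`), the
cleared functional `Λ²M₁₁ − ΛΛ₁M₂ − ΛΛ₂M₁ + Λ₁Λ₂M` is nonnegative — by the (★) identity,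
`ad_pointwise` (FKG of `ν·c`) and `chain_world1_nonneg` at `ρ = 0` and `ρ = 1`. -/
theorem pureChain_functional_nonneg_of_sameSign (U ent' : Finset V) (ν c d d' : Finset V → R)
    (ρ : R) (hρ0 : 0 ≤ ρ) (hρ1 : ρ ≤ 1) (hν0 : ∀ W, 0 ≤ ν W)
    (hν : ∀ s ⊆ U, ∀ t ⊆ U, ν s * ν t ≤ ν (s ∩ t) * ν (s ∪ t))
    (hc0 : ∀ W, 0 ≤ c W) (hd0 : ∀ W, 0 ≤ d W) (hd'0 : ∀ W, 0 ≤ d' W)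
    (hdc : ∀ W, d W ≤ c W) (hd'c : ∀ W, d' W ≤ c W) (hd'd : ∀ W, d' W ≤ d W)
    (hcc : ∀ s t, c s * c t ≤ c (s ∩ t) * c (s ∪ t))
    (hdd : ∀ s t, d s * d t ≤ d (s ∩ t) * d (s ∪ t))
    (hd'd' : ∀ s t, d' s * d' t ≤ d' (s ∩ t) * d' (s ∪ t))
    (hcd : ∀ s t, c s * d t ≤ c (s ∩ t) * d (s ∪ t))
    (hcd' : ∀ s t, c s * d' t ≤ c (s ∩ t) * d' (s ∪ t))
    (hdd' : ∀ s t, d s * d' t ≤ d (s ∩ t) * d' (s ∪ t))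
    (hratio : ∀ s t, s ⊆ t → d s * c t ≤ c s * d t)
    (hratio' : ∀ s t, s ⊆ t → d' s * c t ≤ c s * d' t) (m₁ m₂ : V)
    (hpos0 : 0 < ∑ W ∈ U.powerset, ν W * c W)
    (hpos1 : 0 < ∑ W ∈ U.powerset, ν W * chainMix ∅ ent' 1 c d W)
    (hsign : 0 ≤
      ((∑ W ∈ U.powerset, ν W * chainMix ∅ ent' 1 c d W) *
          (∑ W ∈ U.powerset, ν W * c W * (if m₁ ∈ W then (1 : R) else 0)) -
        (∑ W ∈ U.powerset, ν W * c W) *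
          (∑ W ∈ U.powerset, ν W * chainMix ∅ ent' 1 c d W * (if m₁ ∈ W then (1 : R) else 0))) *
      ((∑ W ∈ U.powerset, ν W * chainMix ∅ ent' 1 c d W) *
          (∑ W ∈ U.powerset, ν W * c W * (if m₂ ∈ W then (1 : R) else 0)) -
        (∑ W ∈ U.powerset, ν W * c W) *
          (∑ W ∈ U.powerset, ν W * chainMix ∅ ent' 1 c d W * (if m₂ ∈ W then (1 : R) else 0)))) :
    0 ≤ (∑ W ∈ U.powerset, ν W * chainMix ∅ ent' ρ c d W) ^ 2 *
          (∑ W ∈ U.powerset, ν W * chainMix ∅ ent' ρ c d' W *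
            ((if m₁ ∈ W then (1 : R) else 0) * (if m₂ ∈ W then (1 : R) else 0)))
        - (∑ W ∈ U.powerset, ν W * chainMix ∅ ent' ρ c d W) *
          (∑ W ∈ U.powerset, ν W * chainMix ∅ ent' ρ c d W * (if m₁ ∈ W then (1 : R) else 0)) *
          (∑ W ∈ U.powerset, ν W * chainMix ∅ ent' ρ c d' W * (if m₂ ∈ W then (1 : R) else 0))
        - (∑ W ∈ U.powerset, ν W * chainMix ∅ ent' ρ c d W) *
          (∑ W ∈ U.powerset, ν W * chainMix ∅ ent' ρ c d W * (if m₂ ∈ W then (1 : R) else 0)) *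
          (∑ W ∈ U.powerset, ν W * chainMix ∅ ent' ρ c d' W * (if m₁ ∈ W then (1 : R) else 0))
        + (∑ W ∈ U.powerset, ν W * chainMix ∅ ent' ρ c d W * (if m₁ ∈ W then (1 : R) else 0)) *
          (∑ W ∈ U.powerset, ν W * chainMix ∅ ent' ρ c d W * (if m₂ ∈ W then (1 : R) else 0)) *
          (∑ W ∈ U.powerset, ν W * chainMix ∅ ent' ρ c d' W) := by
  have hR : ∀ W, ν W * chainMix ∅ ent' ρ c d W =
      (1 - ρ) * (ν W * c W) + ρ * (ν W * chainMix ∅ ent' 1 c d W) := by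
    intro W
    rw [chainMix_affine ∅ ent' ρ c d W, chainMix_zero_empty ent' c d W]; ring
  have hG : ∀ W, ν W * chainMix ∅ ent' ρ c d' W =
      (1 - ρ) * (ν W * c W) + ρ * (ν W * chainMix ∅ ent' 1 c d' W) := by
    intro W
    rw [chainMix_affine ∅ ent' ρ c d' W, chainMix_zero_empty ent' c d' W]; ring
  -- the seven sums
  have s0 : ∑ W ∈ U.powerset, ν W * chainMix ∅ ent' ρ c d W =
      (1 - ρ) * ∑ W ∈ U.powerset, ν W * c W +
        ρ * ∑ W ∈ U.powerset, ν W * chainMix ∅ ent' 1 c d W := by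
    rw [Finset.mul_sum, Finset.mul_sum, ← Finset.sum_add_distrib]
    exact Finset.sum_congr rfl fun W _ => hR W
  have s1 : ∑ W ∈ U.powerset, ν W * chainMix ∅ ent' ρ c d W * (if m₁ ∈ W then (1 : R) else 0) =
      (1 - ρ) * ∑ W ∈ U.powerset, ν W * c W * (if m₁ ∈ W then (1 : R) else 0) +
        ρ * ∑ W ∈ U.powerset, ν W * chainMix ∅ ent' 1 c d W * (if m₁ ∈ W then (1 : R) else 0) := by
    rw [Finset.mul_sum, Finset.mul_sum, ← Finset.sum_add_distrib]
    exact Finset.sum_congr rfl fun W _ => by rw [hR W]; ring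
  have s2 : ∑ W ∈ U.powerset, ν W * chainMix ∅ ent' ρ c d W * (if m₂ ∈ W then (1 : R) else 0) =
      (1 - ρ) * ∑ W ∈ U.powerset, ν W * c W * (if m₂ ∈ W then (1 : R) else 0) +
        ρ * ∑ W ∈ U.powerset, ν W * chainMix ∅ ent' 1 c d W * (if m₂ ∈ W then (1 : R) else 0) := by
    rw [Finset.mul_sum, Finset.mul_sum, ← Finset.sum_add_distrib]
    exact Finset.sum_congr rfl fun W _ => by rw [hR W]; ring
  have g0 : ∑ W ∈ U.powerset, ν W * chainMix ∅ ent' ρ c d' W =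
      (1 - ρ) * ∑ W ∈ U.powerset, ν W * c W +
        ρ * ∑ W ∈ U.powerset, ν W * chainMix ∅ ent' 1 c d' W := by
    rw [Finset.mul_sum, Finset.mul_sum, ← Finset.sum_add_distrib]
    exact Finset.sum_congr rfl fun W _ => hG W
  have g1 : ∑ W ∈ U.powerset, ν W * chainMix ∅ ent' ρ c d' W * (if m₁ ∈ W then (1 : R) else 0) =
      (1 - ρ) * ∑ W ∈ U.powerset, ν W * c W * (if m₁ ∈ W then (1 : R) else 0) +
        ρ * ∑ W ∈ U.powerset, ν W * chainMix ∅ ent' 1 c d' W * (if m₁ ∈ W then (1 : R) else 0) := by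
    rw [Finset.mul_sum, Finset.mul_sum, ← Finset.sum_add_distrib]
    exact Finset.sum_congr rfl fun W _ => by rw [hG W]; ring
  have g2 : ∑ W ∈ U.powerset, ν W * chainMix ∅ ent' ρ c d' W * (if m₂ ∈ W then (1 : R) else 0) =
      (1 - ρ) * ∑ W ∈ U.powerset, ν W * c W * (if m₂ ∈ W then (1 : R) else 0) +
        ρ * ∑ W ∈ U.powerset, ν W * chainMix ∅ ent' 1 c d' W * (if m₂ ∈ W then (1 : R) else 0) := by
    rw [Finset.mul_sum, Finset.mul_sum, ← Finset.sum_add_distrib]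
    exact Finset.sum_congr rfl fun W _ => by rw [hG W]; ring
  have g12 : ∑ W ∈ U.powerset, ν W * chainMix ∅ ent' ρ c d' W *
        ((if m₁ ∈ W then (1 : R) else 0) * (if m₂ ∈ W then (1 : R) else 0)) =
      (1 - ρ) * ∑ W ∈ U.powerset, ν W * c W *
          ((if m₁ ∈ W then (1 : R) else 0) * (if m₂ ∈ W then (1 : R) else 0)) +
        ρ * ∑ W ∈ U.powerset, ν W * chainMix ∅ ent' 1 c d' W *
          ((if m₁ ∈ W then (1 : R) else 0) * (if m₂ ∈ W then (1 : R) else 0)) := by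
    rw [Finset.mul_sum, Finset.mul_sum, ← Finset.sum_add_distrib]
    exact Finset.sum_congr rfl fun W _ => by rw [hG W]; ring
  rw [s0, s1, s2, g0, g1, g2, g12]
  -- the four ingredients of (★)
  have hx0 : ∀ W : Finset V, (0 : R) ≤ if m₁ ∈ W then 1 else 0 := fun W => by
    split_ifs <;> norm_num
  have hy0 : ∀ W : Finset V, (0 : R) ≤ if m₂ ∈ W then 1 else 0 := fun W => by
    split_ifs <;> norm_num
  have hxm : ∀ s t : Finset V, (if m₁ ∈ s then (1 : R) else 0) ≤ if m₁ ∈ s ∪ t then 1 else 0 := by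
    intro s t
    by_cases h : m₁ ∈ s
    · rw [if_pos h, if_pos (Finset.mem_union_left t h)]
    · rw [if_neg h]; exact hx0 _
  have hym : ∀ s t : Finset V, (if m₂ ∈ t then (1 : R) else 0) ≤ if m₂ ∈ s ∪ t then 1 else 0 := by
    intro s t
    by_cases h : m₂ ∈ t
    · rw [if_pos h, if_pos (Finset.mem_union_right s h)]
    · rw [if_neg h]; exact hy0 _
  have hL₀0 : ∀ W, 0 ≤ ν W * c W := fun W => mul_nonneg (hν0 W) (hc0 W)
  have hD : 0 ≤ (∑ W ∈ U.powerset, ν W * c W) *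
        (∑ W ∈ U.powerset, ν W * c W *
          ((if m₁ ∈ W then (1 : R) else 0) * (if m₂ ∈ W then (1 : R) else 0))) -
      (∑ W ∈ U.powerset, ν W * c W * (if m₁ ∈ W then (1 : R) else 0)) *
        (∑ W ∈ U.powerset, ν W * c W * (if m₂ ∈ W then (1 : R) else 0)) := by
    have := ad_pointwise U (fun W => ν W * c W * (if m₁ ∈ W then (1 : R) else 0))
      (fun W => ν W * c W * (if m₂ ∈ W then (1 : R) else 0)) (fun W => ν W * c W)
      (fun W => ν W * c W * ((if m₁ ∈ W then (1 : R) else 0) * (if m₂ ∈ W then (1 : R) else 0)))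
      (fun W => mul_nonneg (hL₀0 W) (hx0 W)) (fun W => mul_nonneg (hL₀0 W) (hy0 W)) hL₀0
      (fun W => mul_nonneg (hL₀0 W) (mul_nonneg (hx0 W) (hy0 W))) ?_
    · linarith
    · intro s hs t ht
      have e1 : ν s * ν t ≤ ν (s ∩ t) * ν (s ∪ t) := hν s hs t ht
      have e2 := hcc s t
      have e3 := hxm s t
      have e4 := hym s t
      calc ν s * c s * (if m₁ ∈ s then (1 : R) else 0) *
            (ν t * c t * (if m₂ ∈ t then (1 : R) else 0))
          = (ν s * ν t) * (c s * c t) *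
              ((if m₁ ∈ s then (1 : R) else 0) * (if m₂ ∈ t then (1 : R) else 0)) := by ring
        _ ≤ (ν (s ∩ t) * ν (s ∪ t)) * (c (s ∩ t) * c (s ∪ t)) *
              ((if m₁ ∈ s ∪ t then (1 : R) else 0) * (if m₂ ∈ s ∪ t then (1 : R) else 0)) := by
            apply mul_le_mul (mul_le_mul e1 e2 (mul_nonneg (hc0 _) (hc0 _))
              (mul_nonneg (hν0 _) (hν0 _)))
              (mul_le_mul e3 e4 (hy0 _) (hx0 _)) (mul_nonneg (hx0 _) (hy0 _))
              (mul_nonneg (mul_nonneg (hν0 _) (hν0 _)) (mul_nonneg (hc0 _) (hc0 _)))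
        _ = ν (s ∩ t) * c (s ∩ t) * (ν (s ∪ t) * c (s ∪ t) *
              ((if m₁ ∈ s ∪ t then (1 : R) else 0) * (if m₂ ∈ s ∪ t then (1 : R) else 0))) := by
            ring
  have hT01 := chain_world1_nonneg U ∅ ent' ν c d d' 0 le_rfl zero_le_one hν0 hν hc0 hd0 hd'0 hdc
    hd'c hcc hdd hd'd' hcd hcd' hdd' hratio hratio' m₁ m₂
  simp only [chainMix_zero_empty] at hT01
  have hT11 := chain_world1_nonneg U ∅ ent' ν c d d' 1 zero_le_one le_rfl hν0 hν hc0 hd0 hd'0 hdc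
    hd'c hcc hdd hd'd' hcd hcd' hdd' hratio hratio' m₁ m₂
  have hbg : ∑ W ∈ U.powerset, ν W * chainMix ∅ ent' 1 c d' W ≤
      ∑ W ∈ U.powerset, ν W * chainMix ∅ ent' 1 c d W :=
    Finset.sum_le_sum fun W _ =>
      mul_le_mul_of_nonneg_left (chainMix_one_mono ∅ ent' hd'd W) (hν0 W)
  exact chain_star_nonneg' _ _ _ _ _ _ _ _ _ _ _ ρ hρ0 hρ1 hpos0 hpos1 hbg hD hT01 hT11 hsign

end PureChain

end Summit.Ventures.PercRepro2.Coin
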